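import Summits.Ventures.LatticeQCDFlow.Scaling.SimulatedTemperingModeGap
import Summits.Ventures.LatticeQCDFlow.Scaling.SimulatedTemperingFiniteCeiling

/-!
HONEST FRAMING: exact (Metropolis-corrected) sampling algorithms for lattice gauge theory; figures
of merit are autocorrelation/cost numbers at stated couplings and volumes; no continuum-physics
claim.

# SimulatedTemperingFrozenCold — WITH A FAST HOT LEVEL AND POINTWISE PERSISTENCE THE COLD DYNAMICS DO NOT MATTER:
# `Gap(stFinSampler ½ μ M) ≥ p·min{1/K, γ₀}/(25(K+1))` FOR ARBITRARY (EVEN COMPLETELY FROZEN) REVERSIBLE COLD UPDATES,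
# `p = min_{x, k ≤ l} μ_k(x)/μ_l(x)` (lean-2 GEN-17, ours)

Venture-side (OURS).  Cell `lqcd-flow` (pub-lqcd), unit `pub-lqcd-lean-2-g17`, 2026-08-25.  The extreme instance of
`Scaling/SimulatedTemperingModeGap`: take EVERY configuration as its own mode (`mode = id`).  Then the within-mode
restriction chains live on single points (Poincaré constant `1` trivially), the mode-restricted overlaps are
`min{μ_l(x), μ_{l+1}(x)}` themselves (`δ = 1`), and the persistence is the pointwise one,
`p·μ_l(x) ≤ μ_k(x)` for `k ≤ l`.  What is left of the hypotheses is a global Poincaré constant `γ₀` of the HOTTEST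
update `M_0` alone; the updates `M_k`, `k ≥ 1`, need only be row-stochastic and `μ_k`-reversible — the identity
matrix (no update at all at the cold levels) is allowed.

## What is proved

* `block_id`, `blockMass_id`, `lawVariance_blockLaw_id` — singleton blocks: mass `μ_k(x)`, block law = point mass
  (variance `0`).
* **`stFinFrozen_spectralGap_ge`** — `K ≥ 1`, positive probability vectors `μ_k` with pointwise persistence
  `p ∈ (0,1]`, `M_k` row-stochastic and `μ_k`-reversible, `γ₀·Var_{μ_0} ≤ 𝓔_{μ_0}(M_0; ·)` ⇒
  `Gap(stFinSampler ½ μ M) ≥ p·min{1/K, γ₀}/(25(K+1))`.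
* **`stFinSampler_isIrreducible_of_hot`** — the sampler is irreducible as soon as the HOT update is (`0 < t < 1`;
  the cold updates arbitrary): down the ladder by level moves, across at level `0`, up again.
* **`stFinFrozen_tauInt_le`** — hence, with an irreducible hot update, EVERY non-constant observable has
  `τ_int(g) ≤ 25(K+1)/(p·min{1/K, γ₀}) − ½ = 25(K+1)·max{K, 1/γ₀}/p − ½`.
* §4 **`stFinPerfectHot_spectralGap_ge`**, **`stFinPerfectHot_tauInt_le`** — EXACT sampling at the hot level
  (`M_0 = limitMatrix μ_0`: an independent draw from `μ_0` — e.g. the heat bath at `β = 0` — so `γ₀ = 1` by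
  `Scaling/SimulatedTemperingFiniteCeiling.perfect_poincare`) and ANYTHING reversible at the cold levels:
  `Gap ≥ p/(25K(K+1))`, `τ_int(g) ≤ 25K(K+1)/p − ½` for every non-constant observable.

Reading (no numerics implied): this is the cleanest form of "tempering imports the hot level's mixing": the price is
the POINTWISE persistence `p` (for an extensive action `p ≈ e^{−(window)·osc(X)}`, `Scaling/TemperingLikelihoodRatio`),
which is why in practice the mixing of intermediate levels inside sectors (`γ_A`, `Scaling/SimulatedTemperingModeGap`
with coarse modes) is what one relies on.  NOT CLAIMED: anything measured; general configuration spaces.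
Literature grade (cell rule): corollary of the chapter; nothing cited as a fact; no new bib keys.
-/

noncomputable section

open Finset
open Literature.Probability.MarkovChains
open Literature.Probability.MarkovChains.Decomposition

namespace Summit.Ventures.LatticeQCDFlow.Scaling

variable {S : Type*} [Fintype S] [DecidableEq S] {K : ℕ} {μ : Fin (K + 1) → S → ℝ}
  {M : Fin (K + 1) → Matrix S S ℝ} {t : ℝ}

/-! ## §1 Singleton blocks -/

omit [DecidableEq S] in
/-- The block of `x` for `mode = id` is `{x}`. [ours] -/
theorem block_id [DecidableEq S] (x : S) : block (id : S → S) x = {x} := by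
  ext y
  simp [block]

/-- Its mass under `ν` is `ν(x)`. [ours] -/
theorem blockMass_id (ν : S → ℝ) (x : S) : blockMass ν (id : S → S) x = ν x := by
  unfold blockMass
  rw [block_id, Finset.sum_singleton]

/-- The block law of a singleton block is a point mass: every variance vanishes. [ours] -/
theorem lawVariance_blockLaw_id {ν : S → ℝ} (hν : ∀ x, 0 < ν x) (x : S) (h : S → ℝ) :
    lawVariance (blockLaw ν (id : S → S) x) h = 0 := by
  have hpt : ∀ y, blockLaw ν (id : S → S) x y = if y = x then 1 else 0 := by
    intro y
    unfold blockLaw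
    rw [blockMass_id]
    by_cases hy : y = x
    · subst hy; simp [(hν y).ne']
    · rw [if_neg (fun e : id y = x => hy e), if_neg hy]
  unfold lawVariance lawMean
  simp_rw [hpt]
  simp

/-! ## §2 The spectral gap with arbitrary cold updates -/

/-- **WITH A FAST HOT LEVEL AND POINTWISE PERSISTENCE THE COLD DYNAMICS DO NOT MATTER:**
`Gap(stFinSampler ½ μ M) ≥ p·min{1/K, γ₀}/(25(K+1))`, the `M_k` (`k ≥ 1`) being ANY row-stochastic `μ_k`-reversible
matrices. [ours] -/
theorem stFinFrozen_spectralGap_ge (hK : 1 ≤ K) (hμ : ∀ k x, 0 < μ k x) (hμ1 : ∀ k, ∑ x, μ k x = 1)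
    (hM : ∀ k, IsRowStochastic (M k)) (hMrev : ∀ k, DetailedBalance (μ k) (M k))
    {p γ₀ : ℝ} (hp : 0 < p) (hp1 : p ≤ 1) (hγ₀ : 0 < γ₀)
    (hpers : ∀ (k l : Fin (K + 1)) (x : S), k ≤ l → p * μ l x ≤ μ k x)
    (hgap0 : ∀ h : S → ℝ, γ₀ * lawVariance (μ 0) h ≤ dirichletForm (μ 0) (M 0) h) :
    p * min (1 / (K : ℝ)) γ₀ / (25 * (K + 1)) ≤ spectralGap (stFinLaw μ) (stFinSampler (1 / 2) μ M) := by
  have h := stFinModeHalf_spectralGap_ge (μ := μ) (M := M) (mode := (id : S → S)) hμ hμ1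
    Function.surjective_id hK hM hMrev hp hp1 one_pos le_rfl hγ₀ one_pos le_rfl
    (fun k l x hkl => by rw [blockMass_id, blockMass_id]; exact hpers k l x hkl)
    (fun l x => by rw [blockMass_id, blockMass_id, block_id, Finset.sum_singleton, one_mul])
    hgap0
    (fun k x h => by
      rw [lawVariance_blockLaw_id (hμ k) x h, mul_zero]
      exact dirichletForm_nonneg (blockLaw_nonneg (fun y => (hμ k y).le) _ _)
        (restrictionChain_isRowStochastic (hM k) _).1 h)
  simpa using h

/-! ## §3 Irreducibility from the hot level alone, and the ceiling for every observable -/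

/-- **The sampler is irreducible as soon as the HOT update is** (`0 < t < 1`, positive level laws; the cold updates
arbitrary): every level is reached from level `0` and leads back to it by level moves. [ours] -/
theorem stFinSampler_isIrreducible_of_hot (hμ : ∀ k x, 0 < μ k x) (hM : ∀ k, IsRowStochastic (M k))
    (hM0 : IsIrreducible (M 0)) (ht0 : 0 < t) (ht1 : t < 1) :
    IsIrreducible (stFinSampler t μ M) := by
  have hP0 := (stFinSampler_isRowStochastic hμ hM ht0.le ht1.le).1
  have hL0 := (stFinLevel_isRowStochastic hμ).1
  refine isIrreducible_of_forall_closed hP0 fun T hT hcl => ?_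
  -- a level move between adjacent levels has positive probability at every configuration
  have step : ∀ k l : Fin (K + 1), (l.val = k.val + 1 ∨ k.val = l.val + 1) → ∀ y, (k, y) ∈ T → (l, y) ∈ T := by
    intro k l hkl y hk
    refine hcl (k, y) hk (l, y) ?_
    have hlk : ((l, y) : Fin (K + 1) × S) ≠ (k, y) := fun e => by
      have := (Prod.mk.inj e).1; subst this; omega
    have hflow := stFinLaw_mul_stFinLevel hμ hlk
    rw [if_pos ⟨rfl, hkl⟩] at hflow
    have hpos : 0 < stFinLaw μ (k, y) * stFinLevel μ (k, y) (l, y) := by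
      rw [hflow]; exact div_pos (lt_min (hμ k y) (hμ l y)) (by positivity)
    have hLpos : 0 < stFinLevel μ (k, y) (l, y) := (mul_pos_iff_of_pos_left (stFinLaw_pos hμ _)).mp hpos
    rw [stFinSampler_apply]
    have hW := (stFinWithin_isRowStochastic hM).1 (k, y) (l, y)
    nlinarith [mul_pos ht0 hLpos]
  -- down to level `0`, and up from level `0`
  have down : ∀ (k : Fin (K + 1)) (y : S), (k, y) ∈ T → ((0 : Fin (K + 1)), y) ∈ T := by
    intro k
    induction k using Fin.induction with
    | zero => intro y h; exact h
    | succ i ih =>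
      intro y h
      exact ih y (step i.succ i.castSucc (Or.inr (by simp [Fin.val_succ])) y h)
  have up : ∀ (k : Fin (K + 1)) (y : S), ((0 : Fin (K + 1)), y) ∈ T → (k, y) ∈ T := by
    intro k
    induction k using Fin.induction with
    | zero => intro y h; exact h
    | succ i ih =>
      intro y h
      exact step i.castSucc i.succ (Or.inl (by simp [Fin.val_succ])) y (ih y h)
  -- level `0` is closed under `M_0`, hence full
  obtain ⟨⟨k₀, x₀⟩, h0⟩ := hT
  have h00 : ((0 : Fin (K + 1)), x₀) ∈ T := down k₀ x₀ h0
  set T0 : Finset S := univ.filter fun z => ((0 : Fin (K + 1)), z) ∈ T with hT0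
  have hcl0 : ∀ z ∈ T0, ∀ w, 0 < M 0 z w → w ∈ T0 := by
    intro z hz w hzw
    rw [hT0, Finset.mem_filter] at hz ⊢
    refine ⟨mem_univ _, hcl (0, z) hz.2 (0, w) ?_⟩
    rw [stFinSampler_apply, stFinWithin_apply, if_pos rfl]
    have : 0 < (1 - t) * M 0 z w := mul_pos (by linarith) hzw
    linarith [mul_nonneg ht0.le (hL0 (0, z) (0, w))]
  have hx₀ : x₀ ∈ T0 := by rw [hT0, Finset.mem_filter]; exact ⟨mem_univ _, h00⟩
  have hT0u := hM0.eq_univ_of_closed (hM 0).1 ⟨x₀, hx₀⟩ hcl0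
  refine Finset.eq_univ_of_forall fun q => ?_
  obtain ⟨l, y⟩ := q
  have hy : y ∈ T0 := by rw [hT0u]; exact mem_univ _
  rw [hT0, Finset.mem_filter] at hy
  exact up l y hy.2

/-- **`τ_int(g) ≤ 25(K+1)/(p·min{1/K, γ₀}) − ½` for every non-constant observable**, the cold updates arbitrary
(row-stochastic, reversible), the hot update irreducible with Poincaré constant `γ₀`. [ours] -/
theorem stFinFrozen_tauInt_le (hK : 1 ≤ K) (hμ : ∀ k x, 0 < μ k x) (hμ1 : ∀ k, ∑ x, μ k x = 1)
    (hM : ∀ k, IsRowStochastic (M k)) (hMrev : ∀ k, DetailedBalance (μ k) (M k)) (hM0 : IsIrreducible (M 0))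
    {p γ₀ : ℝ} (hp : 0 < p) (hp1 : p ≤ 1) (hγ₀ : 0 < γ₀)
    (hpers : ∀ (k l : Fin (K + 1)) (x : S), k ≤ l → p * μ l x ≤ μ k x)
    (hgap0 : ∀ h : S → ℝ, γ₀ * lawVariance (μ 0) h ≤ dirichletForm (μ 0) (M 0) h)
    {g : Fin (K + 1) × S → ℝ} (hg : 0 < lawVariance (stFinLaw μ) g) :
    asympVar g (stFinLaw μ) (stFinSampler (1 / 2) μ M) / (2 * lawVariance (stFinLaw μ) g)
      ≤ 25 * (K + 1) / (p * min (1 / (K : ℝ)) γ₀) - 1 / 2 := by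
  haveI : Nonempty S := by
    by_contra h
    rw [not_nonempty_iff] at h
    have := hμ1 0
    rw [Finset.univ_eq_empty, Finset.sum_empty] at this
    exact zero_ne_one this
  haveI : Nontrivial (Fin (K + 1)) := Fin.nontrivial_iff_two_le.mpr (by omega)
  have ht0 : (0 : ℝ) < 1 / 2 := by norm_num
  have ht1 : (1 / 2 : ℝ) < 1 := by norm_num
  have hP := stFinSampler_isRowStochastic (M := M) hμ hM ht0.le ht1.le
  have hDB := stFinSampler_detailedBalance (t := (1 / 2 : ℝ)) (M := M) hμ hMrev
  have hirr := stFinSampler_isIrreducible_of_hot hμ hM hM0 ht0 ht1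
  have h1 := asympVar_le_spectralGap (stFinLaw_pos hμ) (sum_stFinLaw hμ1) hP hDB hirr g
  have hc := stFinFrozen_spectralGap_ge hK hμ hμ1 hM hMrev hp hp1 hγ₀ hpers hgap0
  have hKr : (1 : ℝ) ≤ K := by exact_mod_cast hK
  have hm : 0 < min (1 / (K : ℝ)) γ₀ := lt_min (by positivity) hγ₀
  have hcpos : 0 < p * min (1 / (K : ℝ)) γ₀ / (25 * (K + 1)) := by positivity
  have h2 : asympVar g (stFinLaw μ) (stFinSampler (1 / 2) μ M)
      ≤ (2 / (p * min (1 / (K : ℝ)) γ₀ / (25 * (K + 1))) - 1) * lawVariance (stFinLaw μ) g := by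
    refine h1.trans (mul_le_mul_of_nonneg_right ?_ hg.le)
    have := div_le_div_of_nonneg_left (by norm_num : (0 : ℝ) ≤ 2) hcpos hc
    linarith
  rw [div_le_iff₀ (by positivity)]
  have e : (25 * (K + 1) / (p * min (1 / (K : ℝ)) γ₀) - 1 / 2) * (2 * lawVariance (stFinLaw μ) g)
      = (2 / (p * min (1 / (K : ℝ)) γ₀ / (25 * (K + 1))) - 1) * lawVariance (stFinLaw μ) g := by
    field_simp
  rw [e]
  exact h2

/-! ## §4 Exact sampling at the hot level -/

/-- **Exact hot sampling, arbitrary cold updates: `Gap ≥ p/(25K(K+1))`** (`M_0 = limitMatrix μ_0`, `K ≥ 1`). [ours] -/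
theorem stFinPerfectHot_spectralGap_ge (hK : 1 ≤ K) (hμ : ∀ k x, 0 < μ k x) (hμ1 : ∀ k, ∑ x, μ k x = 1)
    (hM : ∀ k, IsRowStochastic (M k)) (hMrev : ∀ k, DetailedBalance (μ k) (M k)) (hM0 : M 0 = limitMatrix (μ 0))
    {p : ℝ} (hp : 0 < p) (hp1 : p ≤ 1) (hpers : ∀ (k l : Fin (K + 1)) (x : S), k ≤ l → p * μ l x ≤ μ k x) :
    p / (25 * K * (K + 1)) ≤ spectralGap (stFinLaw μ) (stFinSampler (1 / 2) μ M) := by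
  have hgap0 : ∀ h : S → ℝ, 1 * lawVariance (μ 0) h ≤ dirichletForm (μ 0) (M 0) h := fun h => by
    rw [hM0]; exact perfect_poincare hμ1 0 h
  have h := stFinFrozen_spectralGap_ge hK hμ hμ1 hM hMrev hp hp1 one_pos hpers hgap0
  have hKr : (1 : ℝ) ≤ K := by exact_mod_cast hK
  have hmin : min (1 / (K : ℝ)) 1 = 1 / K := min_eq_left ((div_le_one (by linarith)).mpr hKr)
  rw [hmin] at h
  refine le_trans (le_of_eq ?_) h
  field_simp

/-- **Exact hot sampling, arbitrary cold updates: `τ_int(g) ≤ 25K(K+1)/p − ½` for every non-constant observable.**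
[ours] -/
theorem stFinPerfectHot_tauInt_le (hK : 1 ≤ K) (hμ : ∀ k x, 0 < μ k x) (hμ1 : ∀ k, ∑ x, μ k x = 1)
    (hM : ∀ k, IsRowStochastic (M k)) (hMrev : ∀ k, DetailedBalance (μ k) (M k)) (hM0 : M 0 = limitMatrix (μ 0))
    {p : ℝ} (hp : 0 < p) (hp1 : p ≤ 1) (hpers : ∀ (k l : Fin (K + 1)) (x : S), k ≤ l → p * μ l x ≤ μ k x)
    {g : Fin (K + 1) × S → ℝ} (hg : 0 < lawVariance (stFinLaw μ) g) :
    asympVar g (stFinLaw μ) (stFinSampler (1 / 2) μ M) / (2 * lawVariance (stFinLaw μ) g)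
      ≤ 25 * K * (K + 1) / p - 1 / 2 := by
  have hgap0 : ∀ h : S → ℝ, 1 * lawVariance (μ 0) h ≤ dirichletForm (μ 0) (M 0) h := fun h => by
    rw [hM0]; exact perfect_poincare hμ1 0 h
  have hM0irr : IsIrreducible (M 0) := by rw [hM0]; exact limitMatrix_isIrreducible (hμ 0)
  have h := stFinFrozen_tauInt_le hK hμ hμ1 hM hMrev hM0irr hp hp1 one_pos hpers hgap0 hg
  have hKr : (1 : ℝ) ≤ K := by exact_mod_cast hK
  have hmin : min (1 / (K : ℝ)) 1 = 1 / K := min_eq_left ((div_le_one (by linarith)).mpr hKr)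
  rw [hmin] at h
  refine h.trans (le_of_eq ?_)
  field_simp

end Summit.Ventures.LatticeQCDFlow.Scaling

end
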